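import Summits.Ventures.CertifiedManyBodySolver.Downfold.PressureContinuumRuns
import Summits.Ventures.CertifiedManyBodySolver.Downfold.PressureContinuumRecord
import HarnessLib

/-!
# The P-continuum BRIDGE: an analytic P.12(e) certificate makes the record's gap DECIDED, so the
# `by_P` lookup carries the certified word over the closed gap

Venture CertifiedManyBodySolver, cell `pub/hubbard-downfold`, seat hubbard-downfold-mod-2; namespace
`Summit.Ventures.CertifiedManyBodySolver.Downfold.PCont`. `Downfold.PressureContinuum{,Runs}` is the
ANALYTIC layer (point skeletons, parameter path, `Router.IntervalCert`: the row fires on the interval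
record ⇒ its word holds at every pressure and both end columns route to it); `PressureContinuumRecord`
is the RECORD layer (`PCont.Rec`: computed pressures + words, gap words, reaches; `Rec.lookup` = the
`by_P` item; `Rec.Decided` = interval word equal to both end words). This file joins them:

* `Rec.Faithful R T S` — the record prints, at every computed pressure `P`, the word the router table
  `T` routes the point skeleton `S P` to (the lead's WORDS.tsv discipline: «VERIFIED r36 from
  HOME/router … route byte-identical»).
* `Rec.decided_of_intervalCert` — **a faithful record whose gap `(a, b)` carries the certified row's
  word as its interval word is DECIDED**: the two end words ARE that word
  (`IntervalCert.route_left/route_right`), no separate check of the end columns is needed.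
* `Rec.word_lookup_of_intervalCert` — hence the `by_P` item at EVERY pressure of the closed gap
  `[a, b]` carries the certified word (computed class at the ends, interpolated strictly inside:
  `Rec.conf_lookup_of_mem_gap`), and `Rec.sat_of_intervalCert_of_mem_gap` — that word is TRUE of the
  material's parameters at every such pressure in the sense of the certificate (`IntervalCert.sat`):
  the item is not just printed, it is backed.

Everything is PROVED. WHAT THIS IS NOT: a statement about any material; faithfulness and the
certificate's analytic inputs (path enclosure, sensitivity classes) are hypotheses the files of
record (`router/WORDS.tsv`, `router/P-INTERVALS.tsv`, the descriptor records) are claimed to meet.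
-/

open Set

namespace Summit.Ventures.CertifiedManyBodySolver.Downfold

namespace PCont

namespace Rec

variable {π ω ι : Type*} [LinearOrder π] {R : Rec π ω}

/-- **The record is FAITHFUL to the router**: at every computed pressure the printed word is the
table word the router assigns to that pressure's point skeleton. [folklore] -/
@[folklore]
def Faithful (R : Rec π ω) (T : List (Router.Row ι ω)) (S : π → Skel ι) : Prop :=
  ∀ P ∈ R.pts, ∀ w, Router.route T (S P) = .table w → R.cw P = w

/-- **Certificate ⇒ DECIDED gap.** A faithful record, two consecutive computed pressures `a < b`, an
analytic P.12(e) certificate for the sub-interval on a row `r` of the (consistent) table, and the gap's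
interval word printed as `r.out` ⇒ the gap is `Decided` (both end words equal the interval word).
[folklore] -/
theorem decided_of_intervalCert {T : List (Router.Row ι ω)} {S : π → Skel ι} {H : Skel ι}
    {p : ℝ → ι → ℝ} {ua ub : ℝ} {r : Router.Row ι ω} {a b : π} (hT : Router.Consistent T)
    (hF : R.Faithful T S) (hc : R.Consecutive a b) (hr : r ∈ T)
    (c : Router.IntervalCert (S a) (S b) H p ua ub r) (hgw : R.gw a = some r.out) :
    R.Decided a b r.out :=
  ⟨hc, hgw, hF a hc.1 _ (c.route_left hT hr), hF b hc.2.1 _ (c.route_right hT hr)⟩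

/-- **Certificate ⇒ the `by_P` item carries the certified word over the CLOSED gap** (computed class
at the two ends, interpolated strictly inside; no reach inside the gap). [folklore] -/
theorem word_lookup_of_intervalCert {T : List (Router.Row ι ω)} {S : π → Skel ι} {H : Skel ι}
    {p : ℝ → ι → ℝ} {ua ub : ℝ} {r : Router.Row ι ω} {a b : π} (hT : Router.Consistent T)
    (hF : R.Faithful T S) (hc : R.Consecutive a b) (hr : r ∈ T)
    (c : Router.IntervalCert (S a) (S b) H p ua ub r) (hgw : R.gw a = some r.out)
    (hreach : ∀ P, a < P → P < b → R.rw P = none) {P : π} (haP : a ≤ P) (hPb : P ≤ b) :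
    (R.lookup P).word = some r.out :=
  word_eq_on_gap_of_decided (decided_of_intervalCert hT hF hc hr c hgw) hreach haP hPb

omit [LinearOrder π] in
/-- **… and the word is BACKED**: at every pressure `u ∈ [ua, ub]` of the certified sub-interval the
row `r` — whose word the items carry — holds of the parameter vector `p u` (`IntervalCert.sat`), and a
consistent table lets no other word hold there (`Router.WordHolds.eq`). [folklore] -/
theorem sat_of_intervalCert_of_mem_gap {T : List (Router.Row ι ω)} {S : π → Skel ι} {H : Skel ι}
    {p : ℝ → ι → ℝ} {ua ub : ℝ} {r : Router.Row ι ω} {a b : π} (hT : Router.Consistent T)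
    (hr : r ∈ T) (c : Router.IntervalCert (S a) (S b) H p ua ub r) {u : ℝ} (hu : u ∈ Icc ua ub)
    {w : ω} (hw : Router.WordHolds T w (p u)) : w = r.out :=
  hw.eq hT (c.toSegCert.wordHolds hr u hu)

end Rec

end PCont

end Summit.Ventures.CertifiedManyBodySolver.Downfold
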